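import Summits.CriticalPhenomena.PercolationContinuityZ3.Theorems.PercNearOneGluingNoHeavyLowerTailQ44SingleSourceReduction
import Summits.CriticalPhenomena.PercolationContinuityZ3.Theorems.PercNearOneGluingNoHeavyLowerTailQ44SingleSourceBaseSchemes

/-!
# CORE A of the single-source packing from the maximal-`ab`-member law (R7-A)

Support file for crux `stmt-CriticalPhenomena-4575` (master-family programme, row `Q44`, single-source packing
`g ≥ b1 + h_a`), seat `prim-bnk-1` gen 30; memo `run/shared/lean/prim/prim-l12/FROM-prim-bnk-1-gen30-DENSE-FIBRES-WS.md`.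

Gen 30 re-tested the CORE-A certificate candidates of gens 27–29 with family-free linear algebra on DENSE fibres (all
`2^{#sides}` sub-families of a fibre at once).  The `K4s`-based rules (`R7-W`, anchored schemes with base the maximal
`K4s`-member) turned out to be false in general; the rule that survives every dense test (≈ 7·10⁴ maximal `ab`-members in
≈ 1 500 fibres with up to several hundred core sides, kit `j187128` extends) is

**(R7-A)** in a graph fibre with an `a`-lobe, for every family `𝒮` of sides of the four core types `K1[ab|cy] (11,9)`,
`K2[ab|cy] (11,8)`, `K4[ab] (6,8)`, `K4s[ay|bc] (8,1)` and every `ab`-member `X₀` (types `K1, K2, K4`) contained in no other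
member, some CO-GOOD `K ⊆ X₀` (`ι K = ⊥`, `ι (M \ K)` an AC cell) lies in an odd number of members.

This file shows that (R7-A) closes CORE A:

* `exists_odd_good_fourType_of_R7A` — under (R7-A) every nonempty four-type family has an odd target (a maximal-size
  `ab`-member is contained in no other member — never in a `K4s`-member by the cell table; pure `K4s`-families are certified
  by the symmetric `K4s`-scheme `exists_odd_good_symmetric_K4s`);
* `exists_odd_good_coreA_of_fourType` — the seven-type CORE-A families (a `K4`- and a `K4s`-side present, CORE B excluded)
  reduce to four-type families by the plain branches `Pb/¬K5`, `Pc/¬K1`, `K5/¬Pc` of `…Q44SingleSourceOffCore`;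
* `pack_singleSource_of_R7A_coreB` — the full single-source law on `Fin n` from (R7-A) and the CORE-B statement.

No sorries, no definitions, standard axioms.
-/

namespace Summit.CriticalPhenomena.PercolationContinuityZ3.Theorems

namespace TwoCopyMono

open Finset FourPointAtoms KernelPeeling Literature.Probability.Percolation

variable {n : ℕ}

/-! ## Tables -/

/-- Table: the four core types are among the six non-`Pc` single-source types. [this work] -/
theorem coreFour_subset_six :
    ∀ q ∈ ({(11, 9), (11, 8), (6, 8), (8, 1)} : Finset (Fin 15 × Fin 15)),
      q ∈ ({(6, 7), (11, 9), (11, 8), (6, 8), (6, 1), (8, 1)} : Finset (Fin 15 × Fin 15)) := by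
  decide +kernel

/-- Table: an `ab`-cell (`ab|cy` or `ab|c|y`) does not refine `ay|bc`; so no `K4s`-side contains an `ab`-side. [this work] -/
theorem abType_not_ple_eight :
    ∀ q ∈ ({(11, 9), (11, 8), (6, 8)} : Finset (Fin 15 × Fin 15)), ple q.1 8 = false := by
  decide +kernel

/-- Table: a cell refining both `a|b|cy` and `ay|bc` is `⊥`. [this work] -/
theorem ple_one_ple_eight_eq_zero : ∀ x : Fin 15, ple x 1 = true → ple x 8 = true → x = 0 := by
  decide

/-! ## Four-type families from (R7-A) -/

/-- **Four-type families from (R7-A).**  Graph fibre `(M, C)` with labelling `ι` in which (R7-A) holds.  Then every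
nonempty family of sides of the four core types has an odd target among the goods of `κ T = ι (T ∩ M)`. [this work] -/
theorem exists_odd_good_fourType_of_R7A (a b c y : Fin n) (C M : Finset (Sym2 (Fin n)))
    (ι : Finset (Sym2 (Fin n)) → Fin 15) (hι : ∀ T : Finset (Sym2 (Fin n)), prof a b c y ↑(C ∪ T) = pp (ι T))
    (hR7A : ∀ 𝒮' : Finset (Finset (Sym2 (Fin n))), (∀ S ∈ 𝒮', S ⊆ M) →
      (∀ S ∈ 𝒮', (ι S, ι (M \ S)) ∈ ({(11, 9), (11, 8), (6, 8), (8, 1)} : Finset (Fin 15 × Fin 15))) →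
      ∀ X₀ ∈ 𝒮', (ι X₀, ι (M \ X₀)) ∈ ({(11, 9), (11, 8), (6, 8)} : Finset (Fin 15 × Fin 15)) →
        (∀ S ∈ 𝒮', X₀ ⊆ S → S = X₀) →
        ∃ K : Finset (Sym2 (Fin n)), K ⊆ X₀ ∧ ι K = 0 ∧ isAC (ι (M \ K)) ∧ Odd #(𝒮'.filter (fun S => K ⊆ S)))
    (𝒮 : Finset (Finset (Sym2 (Fin n)))) (hne : 𝒮.Nonempty) (h𝒮M : ∀ S ∈ 𝒮, S ⊆ M)
    (htypes : ∀ S ∈ 𝒮, (ι S, ι (M \ S)) ∈ ({(11, 9), (11, 8), (6, 8), (8, 1)} : Finset (Fin 15 × Fin 15))) :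
    ∃ T ∈ goods (fun T : Finset (Sym2 (Fin n)) => ι (T ∩ M)), Odd #(𝒮.filter (fun S => S ⊆ T)) := by
  classical
  set κ : Finset (Sym2 (Fin n)) → Fin 15 := fun T => ι (T ∩ M) with hκ
  have hmono : ∀ A B : Finset (Sym2 (Fin n)), A ⊆ B → ple (κ A) (κ B) = true := fun A B hAB =>
    ple_fibreMap a b c y C ι hι (Finset.inter_subset_inter hAB (subset_refl M))
  have hκS : ∀ S, S ⊆ M → κ S = ι S := fun S hS => by simp only [hκ, Finset.inter_eq_left.2 hS]
  have hκSc : ∀ S : Finset (Sym2 (Fin n)), κ Sᶜ = ι (M \ S) := fun S => by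
    simp only [hκ]; congr 1; ext e; simp [Finset.mem_sdiff, Finset.mem_inter, and_comm]
  have hmem4 : ∀ S ∈ 𝒮, (ι S, ι (M \ S)) ∈ ({(11, 9), (11, 8), (6, 8)} : Finset (Fin 15 × Fin 15)) ∨
      (ι S, ι (M \ S)) = (8, 1) := by
    intro S hS
    have h := htypes S hS
    simp only [Finset.mem_insert, Finset.mem_singleton] at h ⊢
    tauto
  by_cases hab : ∃ S ∈ 𝒮, (ι S, ι (M \ S)) ∈ ({(11, 9), (11, 8), (6, 8)} : Finset (Fin 15 × Fin 15))
  · -- a maximal-size `ab`-member is contained in no other member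
    obtain ⟨X₀, hX₀f, hX₀max⟩ := Finset.exists_max_image
      (𝒮.filter (fun S => (ι S, ι (M \ S)) ∈ ({(11, 9), (11, 8), (6, 8)} : Finset (Fin 15 × Fin 15)))) Finset.card
      (by obtain ⟨S, hS, hSt⟩ := hab; exact ⟨S, Finset.mem_filter.2 ⟨hS, hSt⟩⟩)
    have hX₀ : X₀ ∈ 𝒮 := (Finset.mem_filter.1 hX₀f).1
    have hX₀t : (ι X₀, ι (M \ X₀)) ∈ ({(11, 9), (11, 8), (6, 8)} : Finset (Fin 15 × Fin 15)) :=
      (Finset.mem_filter.1 hX₀f).2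
    have hX₀M : X₀ ⊆ M := h𝒮M X₀ hX₀
    have hmax : ∀ S ∈ 𝒮, X₀ ⊆ S → S = X₀ := by
      intro S hS hsub
      rcases hmem4 S hS with hSab | hSW
      · exact (Finset.eq_of_subset_of_card_le hsub (hX₀max S (Finset.mem_filter.2 ⟨hS, hSab⟩))).symm
      · exfalso
        have hle : ple (ι X₀) (ι S) = true := ple_fibreMap a b c y C ι hι hsub
        have h8 : ι S = 8 := (Prod.mk.injEq _ _ _ _ ▸ hSW : ι S = 8 ∧ ι (M \ S) = 1).1
        rw [h8] at hle
        have hf := abType_not_ple_eight _ hX₀t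
        rw [hle] at hf
        exact Bool.noConfusion hf
    obtain ⟨K, hKX, hK0, hKAC, hodd⟩ := hR7A 𝒮 h𝒮M htypes X₀ hX₀ hX₀t hmax
    refine exists_odd_good_of_compl_mem (goods κ) (goods_upper κ hmono) 𝒮 K ?_ hodd
    unfold goods
    rw [Finset.mem_filter]
    refine ⟨Finset.mem_univ _, ?_, ?_⟩
    · rw [hκSc K]; exact hKAC
    · rw [compl_compl, hκS K (hKX.trans hX₀M)]; exact hK0
  · -- all members are `K4s`-sides: symmetric `K4s`-scheme with a maximal-size member
    have hall : ∀ S ∈ 𝒮, ι S = 8 ∧ ι (M \ S) = 1 := by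
      intro S hS
      rcases hmem4 S hS with h | h
      · exact absurd ⟨S, hS, h⟩ hab
      · exact (Prod.mk.injEq _ _ _ _ ▸ h : ι S = 8 ∧ ι (M \ S) = 1)
    obtain ⟨W₀, hW₀, hW₀max⟩ := Finset.exists_max_image 𝒮 Finset.card hne
    have hmax : ∀ S ∈ 𝒮, W₀ ⊆ S → S = W₀ := fun S hS hsub =>
      (Finset.eq_of_subset_of_card_le hsub (hW₀max S hS)).symm
    refine exists_odd_good_symmetric_K4s a b c y C M ι hι 𝒮 h𝒮M
      (fun S hS => coreFour_subset_six _ (htypes S hS)) W₀ hW₀ (hall W₀ hW₀).2 hmax (fun S hS => ?_)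
    have h1 : ple (ι (W₀ \ S)) (ι (M \ S)) = true :=
      ple_fibreMap a b c y C ι hι (Finset.sdiff_subset_sdiff (h𝒮M W₀ hW₀) (subset_refl S))
    have h8 : ple (ι (W₀ \ S)) (ι W₀) = true := ple_fibreMap a b c y C ι hι Finset.sdiff_subset
    rw [(hall S hS).2] at h1
    rw [(hall W₀ hW₀).1] at h8
    exact ple_one_ple_eight_eq_zero _ h1 h8

/-! ## Seven-type CORE-A families from four-type families -/

/-- **CORE A from the four-type statement.**  Graph fibre in which every nonempty four-type family has an odd target.
Then every family of the seven single-source types containing a `K4[ab]`- and a `K4s[ay|bc]`-side and not lying in CORE B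
has an odd target (plain branches `Pb/¬K5`, `Pc/¬K1`, `K5/¬Pc`; the residual family is four-type). [this work] -/
theorem exists_odd_good_coreA_of_fourType (a b c y : Fin n) (C M : Finset (Sym2 (Fin n)))
    (ι : Finset (Sym2 (Fin n)) → Fin 15) (hι : ∀ T : Finset (Sym2 (Fin n)), prof a b c y ↑(C ∪ T) = pp (ι T))
    (h4 : ∀ 𝒮' : Finset (Finset (Sym2 (Fin n))), 𝒮'.Nonempty → (∀ S ∈ 𝒮', S ⊆ M) →
      (∀ S ∈ 𝒮', (ι S, ι (M \ S)) ∈ ({(11, 9), (11, 8), (6, 8), (8, 1)} : Finset (Fin 15 × Fin 15))) →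
      ∃ T ∈ goods (fun T : Finset (Sym2 (Fin n)) => ι (T ∩ M)), Odd #(𝒮'.filter (fun S => S ⊆ T)))
    (𝒮 : Finset (Finset (Sym2 (Fin n)))) (h𝒮M : ∀ S ∈ 𝒮, S ⊆ M)
    (htypes : ∀ S ∈ 𝒮, (ι S, ι (M \ S)) ∈
      ({(6, 7), (5, 7), (11, 9), (11, 8), (6, 8), (6, 1), (8, 1)} : Finset (Fin 15 × Fin 15)))
    (hA : (∃ S ∈ 𝒮, (ι S, ι (M \ S)) = (6, 8)) ∧ (∃ S ∈ 𝒮, (ι S, ι (M \ S)) = (8, 1)))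
    (hB : ¬ ((∃ S ∈ 𝒮, (ι S, ι (M \ S)) = (5, 7)) ∧ (∃ S ∈ 𝒮, (ι S, ι (M \ S)) = (11, 9)) ∧
      (∃ S ∈ 𝒮, (ι S, ι (M \ S)) = (6, 1) ∨ (ι S, ι (M \ S)) = (6, 8)))) :
    ∃ T ∈ goods (fun T : Finset (Sym2 (Fin n)) => ι (T ∩ M)), Odd #(𝒮.filter (fun S => S ⊆ T)) := by
  classical
  have hmemP : ∀ S ∈ 𝒮, (ι S, ι (M \ S)) = (6, 7) ∨ (ι S, ι (M \ S)) = (5, 7) ∨ (ι S, ι (M \ S)) = (11, 9) ∨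
      (ι S, ι (M \ S)) = (11, 8) ∨ (ι S, ι (M \ S)) = (6, 8) ∨ (ι S, ι (M \ S)) = (6, 1) ∨ (ι S, ι (M \ S)) = (8, 1) := by
    intro S hS
    have h := htypes S hS
    simp only [Finset.mem_insert, Finset.mem_singleton] at h
    exact h
  have hpair : ∀ S (u v : Fin 15), (ι S, ι (M \ S)) = (u, v) ↔ ι S = u ∧ ι (M \ S) = v := by
    intro S u v; rw [Prod.mk.injEq]
  by_cases h1 : (∃ S ∈ 𝒮, (ι S, ι (M \ S)) = (6, 7)) ∧ ¬ ∃ S ∈ 𝒮, (ι S, ι (M \ S)) = (6, 1)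
  · obtain ⟨⟨S₁, hS₁, hS₁t⟩, hno5⟩ := h1
    refine exists_odd_good_of_maxType a b c y C M ι hι 𝒮 h𝒮M 6 7 ⟨S₁, hS₁, (hpair S₁ 6 7).1 hS₁t⟩
      (fun S hS => tables_branch_Pb.1 _ (htypes S hS)) (fun S hS hle1 hle2 => ?_)
    rcases tables_branch_Pb.2 _ (htypes S hS) hle1 hle2 with h | h
    · exact (hpair S 6 7).1 h
    · exact absurd ⟨S, hS, h⟩ hno5
  · by_cases h2 : (∃ S ∈ 𝒮, (ι S, ι (M \ S)) = (5, 7)) ∧ ¬ ∃ S ∈ 𝒮, (ι S, ι (M \ S)) = (11, 9)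
    · obtain ⟨⟨S₁, hS₁, hS₁t⟩, hno1⟩ := h2
      refine exists_odd_good_of_maxType a b c y C M ι hι 𝒮 h𝒮M 5 7 ⟨S₁, hS₁, (hpair S₁ 5 7).1 hS₁t⟩
        (fun S hS => tables_branch_Pc.1 _ (htypes S hS) (fun h => hno1 ⟨S, hS, h⟩))
        (fun S hS hle1 hle2 => (hpair S 5 7).1 (tables_branch_Pc.2 _ (htypes S hS) hle1 hle2))
    · by_cases h3 : (∃ S ∈ 𝒮, (ι S, ι (M \ S)) = (6, 1)) ∧ ¬ ∃ S ∈ 𝒮, (ι S, ι (M \ S)) = (5, 7)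
      · obtain ⟨⟨S₁, hS₁, hS₁t⟩, hnoc⟩ := h3
        refine exists_odd_good_of_maxType a b c y C M ι hι 𝒮 h𝒮M 6 1 ⟨S₁, hS₁, (hpair S₁ 6 1).1 hS₁t⟩
          (fun S hS => tables_branch_K5.1 _ (htypes S hS) (fun h => hnoc ⟨S, hS, h⟩))
          (fun S hS hle1 hle2 => (hpair S 6 1).1 (tables_branch_K5.2 _ (htypes S hS) hle1 hle2))
      · have hK4 : ∃ S ∈ 𝒮, (ι S, ι (M \ S)) = (6, 8) := hA.1
        have hPc : ¬ ∃ S ∈ 𝒮, (ι S, ι (M \ S)) = (5, 7) := by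
          intro hc
          have hK1 : ∃ S ∈ 𝒮, (ι S, ι (M \ S)) = (11, 9) := by
            by_contra h; exact h2 ⟨hc, h⟩
          obtain ⟨S, hS, hSt⟩ := hK4
          exact hB ⟨hc, hK1, ⟨S, hS, Or.inr hSt⟩⟩
        have hnoK5 : ¬ ∃ S ∈ 𝒮, (ι S, ι (M \ S)) = (6, 1) := fun h => h3 ⟨h, hPc⟩
        have hnoPb : ¬ ∃ S ∈ 𝒮, (ι S, ι (M \ S)) = (6, 7) := fun h => h1 ⟨h, hnoK5⟩
        have hfour : ∀ S ∈ 𝒮, (ι S, ι (M \ S)) ∈ ({(11, 9), (11, 8), (6, 8), (8, 1)} : Finset (Fin 15 × Fin 15)) := by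
          intro S hS
          rcases hmemP S hS with h | h | h | h | h | h | h
          · exact absurd ⟨S, hS, h⟩ hnoPb
          · exact absurd ⟨S, hS, h⟩ hPc
          · rw [h]; decide
          · rw [h]; decide
          · rw [h]; decide
          · exact absurd ⟨S, hS, h⟩ hnoK5
          · rw [h]; decide
        obtain ⟨S, hS, _⟩ := hK4
        exact h4 𝒮 ⟨S, hS⟩ h𝒮M hfour

/-! ## The law from (R7-A) and CORE B -/

/-- **The full single-source packing from (R7-A) and CORE B, all `n`.**  If, for the marked points `a b c y` of `Fin n`,
in every graph fibre with an `a`-lobe (i) (R7-A) holds — every family of `K1[ab|cy]/K2[ab|cy]/K4[ab]/K4s[ay|bc]`-sides has,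
inside each `ab`-member contained in no other member, a co-good with odd containment count — and (ii) every CORE-B
family has an odd target, then on every finite weighted graph on `Fin n`:
`P(ab|c|y)P(a|bcy) + P(ac|b|y)P(a|bcy) + P(ab|cy)P(ac|by) + P(ab|cy)P(ay|bc) + P(ab|c|y)P(ay|bc) + P(ab|c|y)P(a|b|cy) + P(ay|bc)P(a|b|cy)
 ≤ [P(ab|cy)+P(abcy)]·P(a|b|c|y)`. [this work] -/
theorem pack_singleSource_of_R7A_coreB (a b c y : Fin n)
    (hR7A : ∀ (M C : Finset (Sym2 (Fin n))) (ι : Finset (Sym2 (Fin n)) → Fin 15),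
      (∀ T : Finset (Sym2 (Fin n)), prof a b c y ↑(C ∪ T) = pp (ι T)) →
      (∃ T ∈ M.powerset, (ι T, ι (M \ T)) ∈ ({(6, 7), (5, 7)} : Finset (Fin 15 × Fin 15))) →
      ∀ 𝒮' : Finset (Finset (Sym2 (Fin n))), (∀ S ∈ 𝒮', S ⊆ M) →
        (∀ S ∈ 𝒮', (ι S, ι (M \ S)) ∈ ({(11, 9), (11, 8), (6, 8), (8, 1)} : Finset (Fin 15 × Fin 15))) →
        ∀ X₀ ∈ 𝒮', (ι X₀, ι (M \ X₀)) ∈ ({(11, 9), (11, 8), (6, 8)} : Finset (Fin 15 × Fin 15)) →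
          (∀ S ∈ 𝒮', X₀ ⊆ S → S = X₀) →
          ∃ K : Finset (Sym2 (Fin n)), K ⊆ X₀ ∧ ι K = 0 ∧ isAC (ι (M \ K)) ∧ Odd #(𝒮'.filter (fun S => K ⊆ S)))
    (hcoreB : ∀ (M C : Finset (Sym2 (Fin n))) (ι : Finset (Sym2 (Fin n)) → Fin 15),
      (∀ T : Finset (Sym2 (Fin n)), prof a b c y ↑(C ∪ T) = pp (ι T)) →
      (∃ T ∈ M.powerset, (ι T, ι (M \ T)) ∈ ({(6, 7), (5, 7)} : Finset (Fin 15 × Fin 15))) →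
      ∀ 𝒮 : Finset (Finset (Sym2 (Fin n))), 𝒮.Nonempty → (∀ S ∈ 𝒮, S ⊆ M) →
        (∀ S ∈ 𝒮, (ι S, ι (M \ S)) ∈ ({(6, 7), (5, 7), (11, 9), (11, 8), (6, 8), (6, 1), (8, 1)} : Finset (Fin 15 × Fin 15))) →
        ((∃ S ∈ 𝒮, (ι S, ι (M \ S)) = (5, 7)) ∧ (∃ S ∈ 𝒮, (ι S, ι (M \ S)) = (11, 9)) ∧
          (∃ S ∈ 𝒮, (ι S, ι (M \ S)) = (6, 1) ∨ (ι S, ι (M \ S)) = (6, 8))) →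
        ∃ T ∈ goods (fun T : Finset (Sym2 (Fin n)) => ι (T ∩ M)), Odd #(𝒮.filter (fun S => S ⊆ T)))
    (w : Sym2 (Fin n) → unitInterval) :
    cell w a b c y 6 * cell w a b c y 7 +
      cell w a b c y 5 * cell w a b c y 7 +
      cell w a b c y 11 * cell w a b c y 9 +
      cell w a b c y 11 * cell w a b c y 8 +
      cell w a b c y 6 * cell w a b c y 8 +
      cell w a b c y 6 * cell w a b c y 1 +
      cell w a b c y 8 * cell w a b c y 1 ≤
      (cell w a b c y 11 + cell w a b c y 14) * cell w a b c y 0 := by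
  refine pack_singleSource_of_cores a b c y (fun M C ι hι hlobe 𝒮 hne h𝒮M htypes hcore => ?_) w
  by_cases hB : (∃ S ∈ 𝒮, (ι S, ι (M \ S)) = (5, 7)) ∧ (∃ S ∈ 𝒮, (ι S, ι (M \ S)) = (11, 9)) ∧
      (∃ S ∈ 𝒮, (ι S, ι (M \ S)) = (6, 1) ∨ (ι S, ι (M \ S)) = (6, 8))
  · exact hcoreB M C ι hι hlobe 𝒮 hne h𝒮M htypes hB
  · rcases hcore with hA | hB'
    · exact exists_odd_good_coreA_of_fourType a b c y C M ι hι
        (fun 𝒮' hne' h𝒮M' htypes' => exists_odd_good_fourType_of_R7A a b c y C M ι hι (hR7A M C ι hι hlobe) 𝒮' hne' h𝒮M' htypes')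
        𝒮 h𝒮M htypes hA hB
    · exact absurd hB' hB

end TwoCopyMono

end Summit.CriticalPhenomena.PercolationContinuityZ3.Theorems
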